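import Summits.QuantumFields.YangMills.Theorems.ConvexGribovBodyNonSimplyConnectedLatticeGapChainChessboard
import Summits.QuantumFields.YangMills.Theorems.ConvexGribovBodyNonSimplyConnectedLatticeGapStubCorrPullbackCover
import Summits.QuantumFields.YangMills.Theorems.BalabanLadderIRcofEquipartitionSeamUnitDefs
import HarnessLib

/-!
# Line `equipartition_seam` (crux `IRcof`, stmt-QuantumFields-26930): stub S6 `BadRareUnits` — bad rarity at RATE 1

The registered stub S6 of `Cruxes/IRcof/Lines/equipartition_seam.lean` (rev 6) asks, for an interface labelling family `cls` at badness
`a > 0` of a cover datum `(G, H, π, ρH, r)`, for `β_c`, a constant `C` UNIFORM in `β` and thresholds `S_c(β)` with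
`μ̃_β(cls_S⁻¹{none}) ≤ C e^{−S}` for `β ≥ β_c`, `S ≥ S_c(β)` (`BadUnitOn`, landed in `…EquipartitionSeamUnitDefs`).  Clause X0 of
`TwistSectorInterface` pins `cls_S⁻¹{none}` to the explicit bad event `TwistBad π r a S` (small torus `S < 64`, or a chain of `a`-bad
plaquettes with torus steps `≤ 3` and extent `≥ S/16`), whose rarity at rate `1/48` (constant uniform in `β`) is the landed
`torusBadEventRare` (`Theorems/ConvexGribovBodyNonSimplyConnectedLatticeGapTorusBadEventRare.lean`).  Rate `1/48` does not give rate `1`;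
what does is KEEPING `β` in the Peierls rate: each plaquette of an injective bad chain costs `q = e^{−c₀β}` (`largeFieldSparse_explicit`),
a spanning chain has `≥ S/48` plaquettes, so the rate is `c₀β/48 − log 14406 / 48`, which is `≥ 50/48 > 1` as soon as
`14406·q ≤ e^{−50}`, i.e. `β ≥ (50 + log 14406)/c₀`.  This file re-runs the landed torus Peierls argument with that threshold:

* `torusBad_unitRate_base`: every compact `G`, faithful `r`, `a > 0`: `∃ β_c C, 0 ≤ C ∧ ∀ β ≥ β_c, ∀ S, μ_β(Bad_{a,S}) ≤ C e^{−S}`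
  (`C = 12·24·48⁴·e^{49} + e^{64}`, uniform in `β`);
* `torusBad_unitRate_cover`: the same for `μ̃ = wilsonMeasure (r.ρ ∘ π) β` and the event `TwistBad π r a S` (transport along
  `(π ∘ ·)_* μ̃ = μ`, `map_wilsonMeasure_comp_of_surjective`, `corrPullback_plaquetteHolonomy_comp`);
* `badRareUnits_text`: the TEXT of stub S6 `BadRareUnits` verbatim (over the landed unit constants `Labelling`, `BadUnitOn`), with
  `S_c := fun _ => 0` — so that the skeleton closes S6 by `theorem badRareUnits_holds : BadRareUnits := BadRare.badRareUnits_text`.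

The torus chain combinatorics (`torus_exists_injective_chain`, `torus_exists_stepFinset`, `torus_exists_chainFinset`) is copied from the
landed file, where it is private.  CLASS: support ∕ routine (a constant chase in a landed Peierls bound); no wall of census row 47 is
touched.  HONEST LABEL: the Yang–Mills mass gap (Clay) is NOT proved; `IRcof` ∕ `IR` 0 ∕ 1; row 47 class PWP unchanged (walls S3 ∕ S5ᵛ
untouched), mechanism count 0; nothing continuum ∕ OS ∕ Clay.  Source: ideator `ym-ir-idea-22` g5 (lens «solvent»), workfile `Cruxes/IRcof/Lines/equipartition_seam_BadRare.lean`
(crux write 6156afc8779f), verbatim minus the `#print axioms` audit line, 2026-08-28.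

References: R. Peierls, Proc. Camb. Phil. Soc. 32 (1936) 477; E. Seiler, LNP 159 (1982), Ch. 3; T. Balaban, Commun. Math. Phys. 122
(1989) 355 (large-field regions cost `e^{−c β}` per plaquette).
-/

set_option autoImplicit false

noncomputable section

open MeasureTheory
open Literature.MathematicalPhysics.QuantumFieldTheory Literature.MathematicalPhysics.QuantumLattice
open Summit.QuantumFields.YangMills.Theorems.NonSimplyConnectedLatticeGap

namespace Summit.QuantumFields.YangMills.Cruxes.IRcof.EquipartitionSeam.BadRare

/-! ## Torus chain combinatorics (copied from the landed `…TorusBadEventRare`, where it is private) -/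

/-- `dist(x, y) ≤ n` in the torus sup-distance iff every coordinate is within `n`. -/
private theorem torus_tsup_le_iff {L : ℕ} {x y : Site 4 L} {n : ℕ} :
    (Finset.univ.sup fun j : Fin 4 => ((x j - y j).valMinAbs).natAbs) ≤ n ↔ ∀ j, ((x j - y j).valMinAbs).natAbs ≤ n := by
  simp [Finset.sup_le_iff]

/-- Triangle inequality for the torus sup-distance `max_j |(x_j − y_j).valMinAbs|`. -/
private theorem torus_tsup_triangle {L : ℕ} (x y z : Site 4 L) :
    (Finset.univ.sup fun j : Fin 4 => ((x j - z j).valMinAbs).natAbs) ≤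
      (Finset.univ.sup fun j : Fin 4 => ((x j - y j).valMinAbs).natAbs) +
        (Finset.univ.sup fun j : Fin 4 => ((y j - z j).valMinAbs).natAbs) := by
  rw [torus_tsup_le_iff]
  intro j
  rw [show x j - z j = (x j - y j) + (y j - z j) by abel]
  exact ((ZMod.natAbs_valMinAbs_add_le _ _).trans (Int.natAbs_add_le _ _)).trans (add_le_add
    (Finset.le_sup (f := fun j : Fin 4 => ((x j - y j).valMinAbs).natAbs) (Finset.mem_univ j))
    (Finset.le_sup (f := fun j : Fin 4 => ((y j - z j).valMinAbs).natAbs) (Finset.mem_univ j)))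

/-- **A bad chain contains an injective bad chain.** If `c₀, …, c_k` satisfy `Q`, have torus steps `≤ 3` and end-to-end
distance `≥ D`, then some INJECTIVE chain satisfies `Q`, has steps `≤ 3` and length `K` with `D ≤ 3K`. -/
private theorem torus_exists_injective_chain {L : ℕ} {Q : Plaquette 4 L → Prop} {D k : ℕ} (c : Fin (k + 1) → Plaquette 4 L)
    (hQ : ∀ i, Q (c i))
    (hstep : ∀ i : Fin k, (Finset.univ.sup fun j : Fin 4 => (((c i.castSucc).1 j - (c i.succ).1 j).valMinAbs).natAbs) ≤ 3)
    (hlong : D ≤ Finset.univ.sup fun j : Fin 4 => (((c 0).1 j - (c (Fin.last k)).1 j).valMinAbs).natAbs) :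
    ∃ (K : ℕ) (c' : Fin (K + 1) → Plaquette 4 L), Function.Injective c' ∧ (∀ i, Q (c' i)) ∧
      (∀ i : Fin K, (Finset.univ.sup fun j : Fin 4 => (((c' i.castSucc).1 j - (c' i.succ).1 j).valMinAbs).natAbs) ≤ 3) ∧
      D ≤ 3 * K := by
  classical
  let P : ℕ → (ℕ → Plaquette 4 L) → Prop := fun K g => (∀ n ≤ K, Q (g n)) ∧
    (∀ n < K, (Finset.univ.sup fun j : Fin 4 => (((g n).1 j - (g (n + 1)).1 j).valMinAbs).natAbs) ≤ 3) ∧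
      D ≤ Finset.univ.sup fun j : Fin 4 => (((g 0).1 j - (g K).1 j).valMinAbs).natAbs
  have hsplice : ∀ (K : ℕ) (g : ℕ → Plaquette 4 L), P K g → ∀ i j : ℕ, i < j → j ≤ K → g i = g j →
      P (K - (j - i)) (fun n => if n ≤ i then g n else g (n + (j - i))) := by
    rintro K g ⟨h1, h2, h3⟩ i j hij hj he
    refine ⟨fun n hn => ?_, fun n hn => ?_, ?_⟩
    · dsimp only
      split_ifs with c1
      · exact h1 n (by omega)
      · exact h1 _ (by omega)
    · dsimp only
      by_cases c1 : n + 1 ≤ i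
      · rw [if_pos (Nat.le_of_succ_le c1), if_pos c1]
        exact h2 n (by omega)
      by_cases c0 : n ≤ i
      · rw [if_pos c0, if_neg c1, show g n = g j by rw [show n = i by omega, he], show n + 1 + (j - i) = j + 1 by omega]
        exact h2 j (by omega)
      · rw [if_neg c0, if_neg c1, show n + 1 + (j - i) = n + (j - i) + 1 by omega]
        exact h2 _ (by omega)
    · dsimp only
      rw [if_pos (Nat.zero_le i)]
      split_ifs with c1
      · rw [show K - (j - i) = i by omega, he, show j = K by omega]
        exact h3
      · rw [Nat.sub_add_cancel (by omega : j - i ≤ K)]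
        exact h3
  let f : ℕ → Plaquette 4 L := fun n => if h : n ≤ k then c ⟨n, Nat.lt_succ_of_le h⟩ else c 0
  have hf : P k f := by
    refine ⟨fun n hn => ?_, fun n hn => ?_, ?_⟩
    · simp only [f, dif_pos hn]
      exact hQ _
    · simp only [f, dif_pos (Nat.le_of_lt hn), dif_pos (Nat.succ_le_of_lt hn)]
      exact hstep ⟨n, hn⟩
    · simp only [f, dif_pos (Nat.zero_le k), dif_pos (le_refl k)]
      exact hlong
  have hex : ∃ K, ∃ g : ℕ → Plaquette 4 L, P K g := ⟨k, f, hf⟩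
  obtain ⟨g, hg⟩ := Nat.find_spec hex
  have hdist : ∀ n ≤ Nat.find hex, (Finset.univ.sup fun j : Fin 4 => (((g 0).1 j - (g n).1 j).valMinAbs).natAbs) ≤ 3 * n := by
    intro n
    induction n with
    | zero => exact fun _ => by simp [sub_self, ZMod.valMinAbs_zero]
    | succ n ih =>
      intro hn
      have e1 := ih (Nat.le_of_succ_le hn)
      have e2 := hg.2.1 n (Nat.lt_of_succ_le hn)
      have e3 := torus_tsup_triangle (g 0).1 (g n).1 (g (n + 1)).1
      omega
  refine ⟨Nat.find hex, fun i => g i, ?_, fun i => hg.1 i (Nat.le_of_lt_succ i.2), fun i => hg.2.1 i i.2,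
    hg.2.2.trans (hdist _ le_rfl)⟩
  intro s t hst
  by_contra hne
  have hs := s.2
  have ht := t.2
  rcases Nat.lt_or_gt_of_ne (fun e => hne (Fin.ext e)) with hlt | hlt
  · exact Nat.find_min hex (show Nat.find hex - (t - s) < Nat.find hex by omega) ⟨_, hsplice _ g hg s t hlt (by omega) hst⟩
  · exact Nat.find_min hex (show Nat.find hex - (s - t) < Nat.find hex by omega)
      ⟨_, hsplice _ g hg t s hlt (by omega) hst.symm⟩

/-- The step alphabet: the torus plaquettes `(v, o)` with `max_j |v_j.valMinAbs| ≤ 3` lie in a Finset of cardinality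
`≤ 7⁴ · 6 = 14406`. -/
private theorem torus_exists_stepFinset (L : ℕ) : ∃ D : Finset (Plaquette 4 L), D.card ≤ 14406 ∧
    ∀ (x y : Site 4 L) (o : {p : Fin 4 × Fin 4 // p.1 < p.2}),
      (Finset.univ.sup fun j : Fin 4 => ((x j - y j).valMinAbs).natAbs) ≤ 3 → (x - y, o) ∈ D := by
  classical
  obtain ⟨B, hBcard, hBmem⟩ : ∃ B : Finset (Fin 4 → ℤ), B.card = 2401 ∧ ∀ v : Fin 4 → ℤ, (∀ j, -3 ≤ v j ∧ v j ≤ 3) → v ∈ B := by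
    refine ⟨Fintype.piFinset fun _ : Fin 4 => Finset.Icc (-3 : ℤ) 3, ?_, fun v hv =>
      Fintype.mem_piFinset.2 fun j => Finset.mem_Icc.2 (hv j)⟩
    rw [Fintype.card_piFinset, Finset.prod_const, Finset.card_univ, Fintype.card_fin, Int.card_Icc]
    decide
  have h6 : Fintype.card {p : Fin 4 × Fin 4 // p.1 < p.2} = 6 := by decide
  refine ⟨(B.image fun v : Fin 4 → ℤ => fun j => ((v j : ℤ) : ZMod L)) ×ˢ Finset.univ, ?_, fun x y o hx => ?_⟩
  · rw [Finset.card_product, Finset.card_univ, h6]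
    have hc := Finset.card_image_le (s := B) (f := fun v : Fin 4 → ℤ => fun j => ((v j : ℤ) : ZMod L))
    omega
  · refine Finset.mem_product.2 ⟨Finset.mem_image.2 ⟨fun j => (x j - y j).valMinAbs, hBmem _ fun j => ?_,
      funext fun j => ?_⟩, Finset.mem_univ _⟩
    · have h := (torus_tsup_le_iff.1 hx) j
      omega
    · simp only [Pi.sub_apply, ZMod.coe_valMinAbs]

/-- **Peierls counting on the torus.** The chains of `k + 1` torus plaquettes starting in `B` with consecutive base points
within torus sup-distance `3` lie in a Finset of cardinality `≤ |B| · 14406^k`. -/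
private theorem torus_exists_chainFinset (L : ℕ) (B : Finset (Plaquette 4 L)) : ∀ k : ℕ,
    ∃ T : Finset (Fin (k + 1) → Plaquette 4 L), T.card ≤ B.card * 14406 ^ k ∧ ∀ c : Fin (k + 1) → Plaquette 4 L, c 0 ∈ B →
      (∀ i : Fin k, (Finset.univ.sup fun j : Fin 4 => (((c i.castSucc).1 j - (c i.succ).1 j).valMinAbs).natAbs) ≤ 3) → c ∈ T
  | 0 => by
    classical
    refine ⟨B.image fun p _ => p, ?_, fun c h0 _ => ?_⟩
    · rw [pow_zero, mul_one]
      exact Finset.card_image_le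
    · exact Finset.mem_image.2 ⟨c 0, h0, funext fun i => by rw [Fin.fin_one_eq_zero i]⟩
  | k + 1 => by
    classical
    obtain ⟨T, hT, hmem⟩ := torus_exists_chainFinset L B k
    obtain ⟨D, hD, hDmem⟩ := torus_exists_stepFinset L
    refine ⟨(T ×ˢ D).image fun cv => Fin.snoc cv.1 ((cv.1 (Fin.last k)).1 - cv.2.1, cv.2.2), ?_, fun c h0 hstep => ?_⟩
    · calc _ ≤ (T ×ˢ D).card := Finset.card_image_le
        _ = T.card * D.card := by rw [Finset.card_product]
        _ ≤ B.card * 14406 ^ k * 14406 := Nat.mul_le_mul hT hD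
        _ = B.card * 14406 ^ (k + 1) := by ring
    · have hinit : Fin.init c ∈ T :=
        hmem (Fin.init c) (by rw [show Fin.init c 0 = c 0 from congrArg c Fin.castSucc_zero]; exact h0) fun i => by
          have h := hstep i.castSucc
          rwa [Fin.succ_castSucc] at h
      have hlast : (Finset.univ.sup fun j : Fin 4 =>
          (((c (Fin.last k).castSucc).1 j - (c (Fin.last (k + 1))).1 j).valMinAbs).natAbs) ≤ 3 := by
        have h := hstep (Fin.last k)
        rwa [Fin.succ_last] at h
      refine Finset.mem_image.2 ⟨(Fin.init c, ((c (Fin.last k).castSucc).1 - (c (Fin.last (k + 1))).1,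
        (c (Fin.last (k + 1))).2)), Finset.mem_product.2 ⟨hinit, hDmem _ _ _ hlast⟩, ?_⟩
      show Fin.snoc (Fin.init c) ((Fin.init c (Fin.last k)).1 -
          ((c (Fin.last k).castSucc).1 - (c (Fin.last (k + 1))).1), (c (Fin.last (k + 1))).2) = c
      rw [show Fin.init c (Fin.last k) = c (Fin.last k).castSucc from rfl, sub_sub_cancel, Prod.mk.eta]
      exact Fin.snoc_init_self c

/-! ## The β-tracked tail arithmetic -/

/-- Polynomial × geometric ≤ exponential AT RATE 1: `(2S+1)⁴ e^{−50 k₀} ≤ 24 · 48⁴ · e^{49} · e^{−S}` when `S ≤ 48 k₀ + 47`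
(from `y⁴ / 4! ≤ e^y` at `y = (2S+1)/48`, and `50 (S − 47)/48 ≥ S + S/24 − 2350/48`). -/
theorem poly_geom_le_exp_unitRate (S k₀ : ℕ) (hk : S ≤ 48 * k₀ + 47) :
    ((2 : ℝ) * S + 1) ^ 4 * Real.exp (-(50 * (k₀ : ℝ))) ≤ 24 * 48 ^ 4 * Real.exp 49 * Real.exp (-(S : ℝ)) := by
  have h1 : ((2 : ℝ) * S + 1) ^ 4 ≤ 24 * 48 ^ 4 * Real.exp ((2 * S + 1) / 48) := by
    have h := Real.pow_div_factorial_le_exp ((2 * (S : ℝ) + 1) / 48) (by positivity) 4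
    rw [show ((Nat.factorial 4 : ℕ) : ℝ) = 24 by norm_num [Nat.factorial], div_pow, div_div, div_le_iff₀ (by positivity)] at h
    linarith
  have h2 : Real.exp (-(50 * (k₀ : ℝ))) ≤ Real.exp (2350 / 48 - 50 * (S : ℝ) / 48) := by
    refine Real.exp_le_exp.2 ?_
    have : (S : ℝ) ≤ 48 * k₀ + 47 := by exact_mod_cast hk
    linarith
  have h3 : Real.exp ((2 * S + 1) / 48) * Real.exp (2350 / 48 - 50 * (S : ℝ) / 48) =
      Real.exp (2351 / 48) * Real.exp (-(S : ℝ)) := by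
    rw [← Real.exp_add, ← Real.exp_add]
    congr 1
    ring
  calc ((2 : ℝ) * S + 1) ^ 4 * Real.exp (-(50 * (k₀ : ℝ)))
      ≤ (24 * 48 ^ 4 * Real.exp ((2 * S + 1) / 48)) * Real.exp (2350 / 48 - 50 * (S : ℝ) / 48) :=
        mul_le_mul h1 h2 (Real.exp_pos _).le (by positivity)
    _ = 24 * 48 ^ 4 * (Real.exp (2351 / 48) * Real.exp (-(S : ℝ))) := by rw [mul_assoc, h3]
    _ ≤ 24 * 48 ^ 4 * (Real.exp 49 * Real.exp (-(S : ℝ))) := by gcongr; norm_num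
    _ = 24 * 48 ^ 4 * Real.exp 49 * Real.exp (-(S : ℝ)) := by ring

/-! ## The bad event at rate 1, constant uniform in `β` -/

/-- **The bad event of the sector interface has mass `≤ C e^{−S}` in the `(G, r)` torus Wilson theory for ALL `β ≥ β_c`, with ONE
constant `C`** (every compact `G`, faithful continuous unitary `r`, threshold `a > 0`).  Peierls on the torus over
`largeFieldSparse_explicit` with the β-tracked threshold `β_c = max b₀ ((50 + log 14406)/c₀)`: then `14406·e^{−c₀β} ≤ e^{−50}`, an injective
spanning bad chain has `K + 1 ≥ S/48 + 1` plaquettes, the chains number `≤ 6(2S+1)⁴·14406^K`, and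
`μ(Bad) ≤ 12 q (2S+1)⁴ e^{−50⌊S/48⌋} ≤ 12 · 24 · 48⁴ · e^{49} · e^{−S}` (`q ≤ 1`); the disjunct `S < 64` costs `e^{64} e^{−S}`. -/
theorem torusBad_unitRate_base (G : Type) [Group G] [TopologicalSpace G] [IsTopologicalGroup G] [CompactSpace G]
    [MeasurableSpace G] [BorelSpace G] (r : LatticeRep G) (a : ℝ) (ha : 0 < a) :
    ∃ β_c C : ℝ, 0 ≤ C ∧ ∀ β : ℝ, β_c ≤ β → ∀ S : ℕ,
      (wilsonMeasure r.ρ β : Measure (GaugeConfig 4 (2 * S + 1) G))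
        {U | S < 64 ∨ ∃ (k : ℕ) (ch : Fin (k + 1) → Plaquette 4 (2 * S + 1)),
          (∀ i, a ≤ (r.N : ℝ) - (r.ρ (plaquetteHolonomy U (ch i).1 (ch i).2.1.1 (ch i).2.1.2)).trace.re) ∧
          (∀ i : Fin k, (Finset.univ.sup fun j : Fin 4 => (((ch i.castSucc).1 j - (ch i.succ).1 j).valMinAbs).natAbs) ≤ 3) ∧
          S ≤ 16 * (Finset.univ.sup fun j : Fin 4 => (((ch 0).1 j - (ch (Fin.last k)).1 j).valMinAbs).natAbs)} ≤
        ENNReal.ofReal (C * Real.exp (-(S : ℝ))) := by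
  classical
  -- large-field sparseness on the odd torus; the β-tracked threshold
  obtain ⟨c₀, b₀, hc₀, hLFS⟩ := largeFieldSparse_explicit G r a ha
  refine ⟨max b₀ ((50 + Real.log 14406) / c₀), 12 * (24 * 48 ^ 4 * Real.exp 49) + Real.exp 64, by positivity,
    fun β hβ S => ?_⟩
  have hb₀ : b₀ ≤ β := le_trans (le_max_left _ _) hβ
  set q : ℝ := Real.exp (-(c₀ * β)) with hqdef
  have h0 : 50 + Real.log 14406 ≤ β * c₀ := (div_le_iff₀ hc₀).1 (le_trans (le_max_right _ _) hβ)
  have hq : 14406 * q ≤ Real.exp (-50) := by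
    have h2 := Real.exp_le_exp.2 (show Real.log 14406 + -(c₀ * β) ≤ -50 by linarith)
    rwa [Real.exp_add, Real.exp_log (by norm_num : (0 : ℝ) < 14406)] at h2
  have hq1 : q ≤ 1 := by
    rw [hqdef, Real.exp_le_one_iff]
    have hlog : 0 ≤ Real.log 14406 := Real.log_nonneg (by norm_num)
    nlinarith
  set μ : Measure (GaugeConfig 4 (2 * S + 1) G) := wilsonMeasure r.ρ β with hμ
  haveI : IsProbabilityMeasure μ := isProbabilityMeasure_wilsonMeasure (d := 4) (L := 2 * S + 1) r.ρ r.continuous β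
  have hextra : 0 ≤ 12 * (24 * 48 ^ 4 * Real.exp 49) * Real.exp (-(S : ℝ)) := by positivity
  -- the small tori `S < 64`: mass `≤ 1 ≤ e^{64} e^{-S}`
  by_cases hS : S < 64
  · refine prob_le_one.trans ?_
    rw [← ENNReal.ofReal_one]
    refine ENNReal.ofReal_le_ofReal ?_
    have h1 : (1 : ℝ) ≤ Real.exp 64 * Real.exp (-(S : ℝ)) := by
      rw [← Real.exp_add]
      refine Real.one_le_exp ?_
      have : (S : ℝ) ≤ 63 := by exact_mod_cast Nat.le_of_lt_succ hS
      linarith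
    nlinarith
  -- the large tori `S ≥ 64`: `k₀ = ⌊S/48⌋`, the Finsets of admissible chains of length `k₀ + m + 1`
  obtain ⟨k₀, hk₀, hk₀'⟩ : ∃ k₀ : ℕ, k₀ = S / 48 ∧ S ≤ 48 * k₀ + 47 := ⟨S / 48, rfl, by omega⟩
  choose T hTcard hTmem using fun m : ℕ =>
    torus_exists_chainFinset (2 * S + 1) (Finset.univ : Finset (Plaquette 4 (2 * S + 1))) (k₀ + m)
  -- the events "the injective chain `c` is entirely bad" and their large-field bound
  let E : (m : ℕ) → (Fin (k₀ + m + 1) → Plaquette 4 (2 * S + 1)) → Set (GaugeConfig 4 (2 * S + 1) G) := fun m c =>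
    {U | Function.Injective c ∧ ∀ i, a ≤ (r.N : ℝ) - (r.ρ (plaquetteHolonomy U (c i).1 (c i).2.1.1 (c i).2.1.2)).trace.re}
  have hE : ∀ (m : ℕ) (c : Fin (k₀ + m + 1) → Plaquette 4 (2 * S + 1)), μ (E m c) ≤ ENNReal.ofReal (q ^ (k₀ + m + 1)) := by
    intro m c
    by_cases h : Function.Injective c
    · have hX : (Finset.univ.image c).card = k₀ + m + 1 := by
        rw [Finset.card_image_of_injective _ h, Finset.card_univ, Fintype.card_fin]
      have hsub : E m c ⊆ {U | ∀ p ∈ Finset.univ.image c,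
          a ≤ (r.N : ℝ) - (r.ρ (plaquetteHolonomy U p.1 p.2.1.1 p.2.1.2)).trace.re} := by
        intro U hU p hp
        obtain ⟨i, -, rfl⟩ := Finset.mem_image.1 hp
        exact hU.2 i
      have hb := hLFS β hb₀ S (by omega) (Finset.univ.image c)
      rw [hX] at hb
      refine (measure_mono hsub).trans (hb.trans_eq ?_)
      rw [hqdef, ← Real.exp_nat_mul]
      congr 2
      push_cast
      ring
    · rw [Set.eq_empty_of_forall_notMem fun U (hU : U ∈ E m c) => h hU.1, measure_empty]
      exact bot_le
  -- counting
  have hBcard : ((Finset.univ : Finset (Plaquette 4 (2 * S + 1))).card : ℝ) = 6 * (2 * (S : ℝ) + 1) ^ 4 := by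
    rw [Finset.card_univ, Fintype.card_prod, Fintype.card_pi, show Fintype.card {p : Fin 4 × Fin 4 // p.1 < p.2} = 6 by decide]
    simp only [ZMod.card, Finset.prod_const, Finset.card_univ, Fintype.card_fin]
    push_cast
    ring
  set A : ℝ := 6 * (2 * (S : ℝ) + 1) ^ 4 * q with hA
  have hA0 : 0 ≤ A := by rw [hA]; positivity
  have hcard : ∀ m : ℕ, ((T m).card : ENNReal) * ENNReal.ofReal (q ^ (k₀ + m + 1)) ≤
      ENNReal.ofReal (A * Real.exp (-50) ^ (k₀ + m)) := by
    intro m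
    rw [← ENNReal.ofReal_natCast, ← ENNReal.ofReal_mul (by positivity)]
    refine ENNReal.ofReal_le_ofReal ?_
    have hc : ((T m).card : ℝ) ≤ 6 * (2 * (S : ℝ) + 1) ^ 4 * 14406 ^ (k₀ + m) := by
      rw [← hBcard]
      exact_mod_cast hTcard m
    calc ((T m).card : ℝ) * q ^ (k₀ + m + 1) ≤ 6 * (2 * (S : ℝ) + 1) ^ 4 * 14406 ^ (k₀ + m) * q ^ (k₀ + m + 1) := by gcongr
      _ = 6 * (2 * (S : ℝ) + 1) ^ 4 * q * (14406 * q) ^ (k₀ + m) := by ring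
      _ ≤ 6 * (2 * (S : ℝ) + 1) ^ 4 * q * Real.exp (-50) ^ (k₀ + m) := by gcongr
      _ = A * Real.exp (-50) ^ (k₀ + m) := by rw [hA]
  -- summation
  have hr0 : 0 ≤ Real.exp (-50) := (Real.exp_pos _).le
  have hr1 : Real.exp (-50) < 1 := Real.exp_lt_one_iff.2 (by norm_num)
  have hsum : HasSum (fun m : ℕ => A * Real.exp (-50) ^ (k₀ + m)) (A * Real.exp (-50) ^ k₀ * (1 - Real.exp (-50))⁻¹) := by
    rw [show (fun m : ℕ => A * Real.exp (-50) ^ (k₀ + m)) = fun m => A * Real.exp (-50) ^ k₀ * Real.exp (-50) ^ m from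
      funext fun m => by ring]
    exact (hasSum_geometric_of_lt_one hr0 hr1).mul_left _
  have hμB : μ (⋃ m : ℕ, ⋃ c ∈ T m, E m c) ≤ ENNReal.ofReal (A * Real.exp (-50) ^ k₀ * (1 - Real.exp (-50))⁻¹) :=
    calc μ (⋃ m : ℕ, ⋃ c ∈ T m, E m c) ≤ ∑' m, μ (⋃ c ∈ T m, E m c) := measure_iUnion_le _
      _ ≤ ∑' m, ∑ c ∈ T m, μ (E m c) := ENNReal.tsum_le_tsum fun m => measure_biUnion_finset_le _ _
      _ ≤ ∑' m, ∑ c ∈ T m, ENNReal.ofReal (q ^ (k₀ + m + 1)) := ENNReal.tsum_le_tsum fun m => Finset.sum_le_sum fun c _ => hE m c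
      _ = ∑' m, ((T m).card : ENNReal) * ENNReal.ofReal (q ^ (k₀ + m + 1)) := by simp only [Finset.sum_const, nsmul_eq_mul]
      _ ≤ ∑' m, ENNReal.ofReal (A * Real.exp (-50) ^ (k₀ + m)) := ENNReal.tsum_le_tsum fun m => hcard m
      _ = ENNReal.ofReal (A * Real.exp (-50) ^ k₀ * (1 - Real.exp (-50))⁻¹) := by
        rw [← ENNReal.ofReal_tsum_of_nonneg (fun m => mul_nonneg hA0 (pow_nonneg hr0 _)) hsum.summable, hsum.tsum_eq]
  -- arithmetic (β-uniform constant: `q ≤ 1`)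
  have hfin : A * Real.exp (-50) ^ k₀ * (1 - Real.exp (-50))⁻¹ ≤
      (12 * (24 * 48 ^ 4 * Real.exp 49) + Real.exp 64) * Real.exp (-(S : ℝ)) := by
    have he2 : Real.exp (-50) ≤ 1 / 2 := by
      have h1 := Real.add_one_le_exp (50 : ℝ)
      have h2 : Real.exp (-50) * Real.exp 50 = 1 := by rw [← Real.exp_add]; norm_num
      nlinarith [Real.exp_pos (-50 : ℝ)]
    have hinv : (1 - Real.exp (-50))⁻¹ ≤ 2 := inv_le_of_inv_le₀ (by norm_num) (by rw [inv_eq_one_div]; linarith)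
    have hgeom : Real.exp (-50) ^ k₀ = Real.exp (-(50 * (k₀ : ℝ))) := by
      rw [← Real.exp_nat_mul]
      congr 1
      ring
    have hpoly := poly_geom_le_exp_unitRate S k₀ hk₀'
    have hpos : 0 ≤ Real.exp 64 * Real.exp (-(S : ℝ)) := by positivity
    have hKpos : 0 ≤ 24 * 48 ^ 4 * Real.exp 49 * Real.exp (-(S : ℝ)) := by positivity
    calc A * Real.exp (-50) ^ k₀ * (1 - Real.exp (-50))⁻¹ ≤ A * Real.exp (-50) ^ k₀ * 2 := by gcongr
      _ = 12 * q * (((2 : ℝ) * S + 1) ^ 4 * Real.exp (-(50 * (k₀ : ℝ)))) := by rw [hgeom, hA]; ring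
      _ ≤ 12 * q * (24 * 48 ^ 4 * Real.exp 49 * Real.exp (-(S : ℝ))) := by gcongr
      _ ≤ 12 * 1 * (24 * 48 ^ 4 * Real.exp 49 * Real.exp (-(S : ℝ))) := by gcongr
      _ ≤ 12 * 1 * (24 * 48 ^ 4 * Real.exp 49 * Real.exp (-(S : ℝ))) + Real.exp 64 * Real.exp (-(S : ℝ)) :=
        le_add_of_nonneg_right hpos
      _ = (12 * (24 * 48 ^ 4 * Real.exp 49) + Real.exp 64) * Real.exp (-(S : ℝ)) := by ring
  -- covering of the bad event by the events of injective admissible chains of length `k₀ + m + 1`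
  refine (measure_mono fun U hU => ?_).trans (hμB.trans (ENNReal.ofReal_le_ofReal hfin))
  rcases hU with h64 | ⟨k, ch, hbad, hst, hlong⟩
  · exact absurd h64 hS
  obtain ⟨K, c', hinj, hQ, hst', hD⟩ := torus_exists_injective_chain
    (Q := fun p => a ≤ (r.N : ℝ) - (r.ρ (plaquetteHolonomy U p.1 p.2.1.1 p.2.1.2)).trace.re) ch hbad hst le_rfl
  obtain ⟨m, rfl⟩ := Nat.exists_eq_add_of_le (show k₀ ≤ K by omega)
  exact Set.mem_iUnion.2 ⟨m, Set.mem_iUnion₂.2 ⟨c', hTmem m c' (Finset.mem_univ _) hst', ⟨hinj, hQ⟩⟩⟩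

/-- **The bad event `TwistBad π r a S` has mass `≤ C e^{−S}` under the cover theory `(H, r ∘ π)` for all `β ≥ β_c`, one `C`**:
transport of `torusBad_unitRate_base` along `(π ∘ ·)_* μ̃ = μ` (the event depends on `V` only through `π ∘ V`). -/
theorem torusBad_unitRate_cover {G H : Type} [Group G] [TopologicalSpace G] [IsTopologicalGroup G] [CompactSpace G]
    [MeasurableSpace G] [BorelSpace G] [Group H] [TopologicalSpace H] [IsTopologicalGroup H] [CompactSpace H]
    [MeasurableSpace H] [BorelSpace H] (π : H →* G) (hπ : Continuous π) (hsurj : Function.Surjective π)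
    (r : LatticeRep G) (a : ℝ) (ha : 0 < a) :
    ∃ β_c C : ℝ, ∀ β : ℝ, β_c ≤ β → ∀ S : ℕ,
      ((wilsonMeasure (r.ρ.comp π) β : Measure (GaugeConfig 4 (2 * S + 1) H)) {V | TwistBad π r a S V}).toReal ≤
        C * Real.exp (-(S : ℝ)) := by
  haveI : SecondCountableTopology G := (r.continuous.isClosedEmbedding r.injective).isEmbedding.secondCountableTopology
  obtain ⟨β_c, C, hC0, hbase⟩ := torusBad_unitRate_base G r a ha
  refine ⟨β_c, C, fun β hβ S => ?_⟩
  -- `(π ∘ ·)_* μ̃ = μ`, so `μ̃ (Φ ⁻¹' s) ≤ μ s` for every set `s`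
  have key : ∀ s : Set (GaugeConfig 4 (2 * S + 1) G),
      wilsonMeasure (r.ρ.comp π) β ((fun (V : GaugeConfig 4 (2 * S + 1) H) (e : Edge 4 (2 * S + 1)) => π (V e)) ⁻¹' s) ≤
        (wilsonMeasure r.ρ β : Measure (GaugeConfig 4 (2 * S + 1) G)) s := fun s =>
    (Measure.le_map_apply (corrPullback_measurable_comp (d := 4) (L := 2 * S + 1) π hπ).aemeasurable s).trans_eq
      (by rw [map_wilsonMeasure_comp_of_surjective (d := 4) (L := 2 * S + 1) π hπ hsurj r.ρ r.continuous β])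
  refine ENNReal.toReal_le_of_le_ofReal (by positivity) (((measure_mono fun V hV => ?_).trans (key _)).trans (hbase β hβ S))
  simp only [TwistBad, Set.mem_preimage, Set.mem_setOf_eq, corrPullback_plaquetteHolonomy_comp] at hV ⊢
  exact hV

/-! ## Stub S6 of the skeleton, by its TEXT -/

/-- **Stub S6 `BadRareUnits` of `Cruxes/IRcof/Lines/equipartition_seam.lean` (rev 6), verbatim text** — bad rarity at rate 1 with a
constant uniform in `β` and thresholds `S_c β := 0`, for every interface labelling family (clause X0 rewrites `cls_S⁻¹{none}` as
`TwistBad π r a S`; `torusBad_unitRate_cover`).  The hypotheses on `ker π`, simple connectivity, `ρH` and the seven other interface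
clauses are not used. -/
theorem badRareUnits_text :
    ∀ (G : Type) [Group G] [TopologicalSpace G] [IsTopologicalGroup G] [CompactSpace G] [MeasurableSpace G]
    [BorelSpace G], IsCompactSimpleLieGroup G → ∀ (H : Type) [Group H] [TopologicalSpace H] [IsTopologicalGroup H]
    [CompactSpace H] [MeasurableSpace H] [BorelSpace H], IsCompactSimpleLieGroup H → SimplyConnectedSpace H →
    ∀ (π : H →* G), Continuous π → Function.Surjective π → π.ker ≤ Subgroup.center H → (π.ker : Set H).Finite →
    π.ker ≠ ⊥ → ∀ (ρH : LatticeRep H) (r : LatticeRep G) (a : ℝ) (cls : Labelling π),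
    (∀ S : ℕ, TwistSectorInterface π ρH r a S (cls S)) → 0 < a →
      ∃ (β_c C : ℝ) (S_c : ℝ → ℕ), ∀ β : ℝ, β_c ≤ β → BadUnitOn π r β cls (S_c β) C := by
  intro G _ _ _ _ _ _ _hG H _ _ _ _ _ _ _hH _hsc π hπ hsurj _hker _hfin _hnt ρH r a cls hI ha
  obtain ⟨β_c, C, h⟩ := torusBad_unitRate_cover π hπ hsurj r a ha
  refine ⟨β_c, C, fun _ => 0, fun β hβ => ?_⟩
  intro S _hS
  rw [show (cls S) ⁻¹' {none} = {V | TwistBad π r a S V} from Set.ext fun V => (hI S).2.1 V]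
  exact h β hβ S

end Summit.QuantumFields.YangMills.Cruxes.IRcof.EquipartitionSeam.BadRare

end
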